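import Summits.ResolutionOfSingularities.ResolutionOfSingularities.Theses.HilbertSamuelElimination
import Summits.ResolutionOfSingularities.ResolutionOfSingularities.Theorems.HilbertSamuelEliminationSigmaMaxModificationsStubCentreSeqPackage
import Literature.AlgebraicGeometry.Resolution.SurfaceResolutionSigmaMaxElimination
import Literature.AlgebraicGeometry.Resolution.HilbertSamuelLowerBound
import Literature.AlgebraicGeometry.Resolution.HilbertSamuelIsolatedSingularities
import Literature.AlgebraicGeometry.Resolution.RegularLocusDense
import Literature.AlgebraicGeometry.Resolution.ExcellentRingsFieldProofs
import Mathlib.AlgebraicGeometry.Morphisms.Proper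
import Mathlib.AlgebraicGeometry.Noetherian
import HarnessLib

/-!
# Elimination ⇒ modification (crux `SigmaMaxModifications`, stmt-ResolutionOfSingularities-18506,
# line `Sketch`): the per-instance bridge and the known slice `dim X ≤ 2`, `N = 2`

Helper lemmas (`--supports`) of the lead skeleton of the crux
`Summit.ResolutionOfSingularities.ResolutionOfSingularities.Theses.HilbertSamuelElimination.SigmaMaxModifications`.

* `sigmaMaxModification_of_centreSeq` — **EliminationIsModification, per instance** (the bridge
  foreseen in the route's TWO-LAYER PLAN): for `X` reduced, locally of finite type over a field,
  not regular, `N ≥ dim X`, every finite blow-up sequence `s : CentreSeq X` whose centres lie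
  over the Hilbert–Samuel locus `X_max`, along whose composite `H^N` does not increase, and
  which kills the maximal values of `Σ_X`, composes to a `Σ^max`-MODIFICATION of `X` at level
  `N` — literally the `∃`-body of the crux at `(X, N)` written with `Scheme.hsFun`,
  `Scheme.hsMaxLocus`, `Scheme.hsValues` (the route decl's inline `H^N` is `Scheme.hsFun` by
  `rfl`). Ingredients: the landed stub `stub_centreSeq_package` with `T = X_max`, and the dense
  open `Reg X ⊆ X ∖ X_max` (`Scheme.hsMaxLocus_subset_compl_regularLocus`,
  `Scheme.dense_regularLocus`, `Scheme.isOpen_regularLocus_of_isQuasiExcellent`).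
* `sigmaMaxModifications_dim_le_two` — **the known slice**: for `dim X ≤ 2` and `N = 2` the
  crux's conclusion follows from the tree's named fact
  `CossartJannsenSaito2020_sigmaMaxElimination` (CJS Thm. 6.28 + Thm. 3.10 (1) + Def. 6.14
  gluing, dimension `≤ 2`), whose shape is exactly the hypothesis of the bridge. CONDITIONAL on
  that (undischarged) fact; it records that the crux is the printed theorem in the printed
  range and isolates what is open (dimension `≥ 3`, and `N > 2` in dimension `≤ 2`).

## Sources

* V. Cossart, U. Jannsen, S. Saito, LNM 2270 (2020), Def. 6.15, Rem. 6.13, Thm. 6.28, Cor. 6.18.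
  [CossartJannsenSaito2020]
-/

set_option linter.dupNamespace false -- mandated namespace of this single-conjunct summit

noncomputable section

open CategoryTheory AlgebraicGeometry TopologicalSpace
open Literature.AlgebraicGeometry.Resolution Literature.RingTheory.HilbertSamuel

namespace Summit.ResolutionOfSingularities.ResolutionOfSingularities.Theorems.SigmaMaxModifications.Sketch

/-- **Elimination ⇒ modification (CJS Def. 6.15, per instance).** For `X` reduced, locally of
finite type over a field `k`, not regular, and `N ≥ dim X`: a finite sequence of blow-ups
`s : CentreSeq X` with centres over `X_max = Scheme.hsMaxLocus X N`, along whose composite the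
Hilbert–Samuel function `H^N` does not increase, and after which no maximal value of `Σ_X`
survives, composes to a `Σ^max`-modification: `s.comp : s.top ⟶ X` is proper, `s.top` is reduced
of dimension `≤ N`, `s.comp` is an isomorphism over every open inside `X ∖ X_max`, the preimage
of `X ∖ X_max` is dense (it contains the preimage of the dense open `Reg X`), `H^N` does not
increase and (ME2) holds. [cite: CossartJannsenSaito2020, Def. 6.15, Rem. 6.13] -/
theorem sigmaMaxModification_of_centreSeq :
    ∀ (k : Type) [Field k] (X : Scheme.{0}) (f : X ⟶ Spec (.of k)), LocallyOfFiniteType f →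
      IsReduced X → ¬ Scheme.IsRegular X → ∀ N : ℕ, topologicalKrullDim X ≤ (N : WithBot ℕ∞) →
      ∀ s : CentreSeq X, s.CentresOver (Scheme.hsMaxLocus X N) →
      (∀ x' : s.top, Scheme.hsFun s.top N x' ≤ Scheme.hsFun X N (s.comp.base x')) →
      (∀ ν : ℕ → ℕ, Maximal (· ∈ Scheme.hsValues X N) ν → ν ∉ Scheme.hsValues s.top N) →
      ∃ (X' : Scheme.{0}) (π : X' ⟶ X), IsProper π ∧ IsReduced X' ∧
        topologicalKrullDim X' ≤ (N : WithBot ℕ∞) ∧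
        (∀ U : X.Opens, (U : Set X) ⊆ (Scheme.hsMaxLocus X N)ᶜ → IsIso (π ∣_ U)) ∧
        Dense ((fun x' => π.base x') ⁻¹' (Scheme.hsMaxLocus X N)ᶜ) ∧
        (∀ x' : X', Scheme.hsFun X' N x' ≤ Scheme.hsFun X N (π.base x')) ∧
        ∀ ν : ℕ → ℕ, Maximal (· ∈ Scheme.hsValues X N) ν → ν ∉ Scheme.hsValues X' N := by
  intro k _ X f hft hred hreg N hdim s hover hmono hME2
  haveI := hft
  haveI := hred
  haveI : IsLocallyNoetherian X := LocallyOfFiniteType.isLocallyNoetherian f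
  have hqe : Scheme.IsQuasiExcellent X :=
    Scheme.isQuasiExcellent_of_locallyOfFiniteType Stacks07QW_field_holds f
  obtain ⟨hprop, hsred, hsdim, hiso, hdense⟩ :=
    stub_centreSeq_package X N hdim (Scheme.hsMaxLocus X N) s hover
  have hstalk := fun x => exists_ringKrullDim_stalk_eq_of_topologicalKrullDim_le (X := X) hdim x
  have hsub : Scheme.hsMaxLocus X N ⊆ (Scheme.regularLocus X)ᶜ :=
    Scheme.hsMaxLocus_subset_compl_regularLocus hstalk hreg
  let U₀ : X.Opens := ⟨Scheme.regularLocus X, Scheme.isOpen_regularLocus_of_isQuasiExcellent hqe⟩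
  have hU₀ : Dense (U₀ : Set X) := Scheme.dense_regularLocus X
  have hU₀sub : (U₀ : Set X) ⊆ (Scheme.hsMaxLocus X N)ᶜ := Set.subset_compl_comm.mp hsub
  have hd : Dense ((fun x' => s.comp.base x') ⁻¹' (Scheme.hsMaxLocus X N)ᶜ) :=
    (hdense U₀ hU₀ hU₀sub).mono (Set.preimage_mono hU₀sub)
  exact ⟨s.top, s.comp, hprop, hsred, hsdim, hiso, hd, hmono, hME2⟩

/-- **The known slice of the crux: `dim X ≤ 2`, `N = 2`** (CJS Thm. 6.28 with Thm. 3.10 (1) and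
the gluing of Def. 6.14, as vendored in the tree's named fact
`CossartJannsenSaito2020_sigmaMaxElimination`): for `X` reduced, locally of finite type and
quasi-compact over a field, not regular, of dimension `≤ 2`, there is a `Σ^max`-modification at
level `N = 2` — the `∃`-body of `SigmaMaxModifications` at `(X, 2)`. CONDITIONAL on the named
fact (taken as the hypothesis `h`). [cite: CossartJannsenSaito2020, Thm. 6.28, Def. 6.15, Cor. 6.18] -/
theorem sigmaMaxModifications_dim_le_two :
    CossartJannsenSaito2020_sigmaMaxElimination.{0} →
      ∀ (k : Type) [Field k] (X : Scheme.{0}) (f : X ⟶ Spec (.of k)), LocallyOfFiniteType f →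
        QuasiCompact f → IsReduced X → ¬ Scheme.IsRegular X → topologicalKrullDim X ≤ 2 →
        ∃ (X' : Scheme.{0}) (π : X' ⟶ X), IsProper π ∧ IsReduced X' ∧
          topologicalKrullDim X' ≤ ((2 : ℕ) : WithBot ℕ∞) ∧
          (∀ U : X.Opens, (U : Set X) ⊆ (Scheme.hsMaxLocus X 2)ᶜ → IsIso (π ∣_ U)) ∧
          Dense ((fun x' => π.base x') ⁻¹' (Scheme.hsMaxLocus X 2)ᶜ) ∧
          (∀ x' : X', Scheme.hsFun X' 2 x' ≤ Scheme.hsFun X 2 (π.base x')) ∧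
          ∀ ν : ℕ → ℕ, Maximal (· ∈ Scheme.hsValues X 2) ν → ν ∉ Scheme.hsValues X' 2 := by
  intro h k _ X f hft hqc hred hreg hdim
  haveI := hft
  haveI := hqc
  haveI := hred
  haveI : IsNoetherian X := Scheme.isNoetherian_of_finiteType_over_field f
  have hexc : Scheme.IsExcellent X :=
    Scheme.isExcellent_of_locallyOfFiniteType Stacks07QW_field_holds f
  obtain ⟨s, hover, hmono, hME2⟩ := h X hexc hdim hreg
  exact sigmaMaxModification_of_centreSeq k X f hft hred hreg 2 (by exact_mod_cast hdim) s hover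
    hmono hME2

end Summit.ResolutionOfSingularities.ResolutionOfSingularities.Theorems.SigmaMaxModifications.Sketch

end
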